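import Summits.BirchSwinnertonDyer.Rank1Residual.Additive.DisegniLineValues
import Literature.NumberTheory.EllipticCurves.Disegni2017.CyclotomicLinePointsProofs
import Literature.NumberTheory.EllipticCurves.RankinSelbergBaseChangeDirichlet
import Literature.NumberTheory.EllipticCurves.ModularSymbolsHeckeProofs
import HarnessLib

/-!
# STEP B of the kernel derivation of `hFact`: Disegni's line function takes the value
# `c · v_f(χ_θ) · v_{f′}(χ_θ)` at the Mazur–Tate–Teitelbaum point `χ_θ(γ) − 1` of EVERY typed character
# (Artin formalism ∘ coefficient bookkeeping ∘ STEP A; cell `bsd-addord`, seat `bsd-addord-gz` gen 4)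

HONEST FRAMING (cell `bsd-addord`; PARTITION (D-0054): EXCLUDED-DOMAIN additive rows §E, B6 = O7-ord r1 ×
every consumer of hFact — types-the-object-of; booked 0). THEOREMS ONLY. Inputs DISPLAYED as hypotheses:
the literature seat's named fact `rankinSelbergEulerProductHecke_baseChangeDirichlet_eq` (p408789, Artin
formalism for `BC_{K/ℚ}`: `RS(f_E, θ∘N_K, s) = L(f_E⊗θ, s)·L(f_E⊗θκ_K, s)` on `re s > 2`), its predicate
`CycLineInterpolation ι K fE α Car G` (p408713, Disegni 2017 Thm. A on the line), and two COEFFICIENT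
relations supplied by the final assembly from the tree's quadratic-twist theorems: `a_n(f_E) = (n/p)·a_n(f)`
(`E = V ⊗ ε`, `f` the newform of `V`; tree `intCast_LFunction_eq_jacobiChar_mul_cuspCoeff`) and
`a_n(f′) = κ_K(n)·a_n(f)` (`f′` the newform of `V ⊗ κ_K`; tree `LFunction_quadraticTwist_apply_of_isGloballyMinimal`).

* §1 `twistedLSeries_eq_of_coeff_legendre`, `twistedLSeries_mul_eq_of_coeff_kronecker` — the two
  Dirichlet-series identities `L(f_E ⊗ θ, s) = L(f ⊗ θε, s)`, `L(f_E ⊗ θκ, s) = L(f′ ⊗ θε, s)` (termwise).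
* §2 **`hasLineValueAt_twin_of_cycLineInterpolation`** — for every even `θ` mod `p^{m+1}` of `p`-power
  order, primitive unless `m = 0`: `G(χ_θ(γ) − 1) = c · v_f(χ_θ) · v_{f′}(χ_θ)` with
  `c = ι⁻¹(u · Car · Ω⁺_f · Ω⁺_{f′})`, choosing as entire continuation of the Rankin–Selberg product THE
  PRODUCT of the continuations of the two twisted series (`exists_differentiable_eq_twistedLSeries_holds`),
  so that no uniqueness of continuation is needed; STEP A (`cycLineValue_eq_const_mul_branchValues`) and the
  twin dictionary (`twin_apply_cyclotomicGenerator_sub_one`) finish.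

What is NOT here: the passage to ALL `ℂ_p`-valued characters + the coefficient extraction (next file,
via `exists_eq_twin_of_isOfFinOrder` + p408899), the heights (STEP C).

References: [Disegni2017] Thm. A; [Gross2004] §3, §13 (Artin formalism); [MazurTateTeitelbaum1986Invent]
§I.8, §I.14; cell sheet `run/shared/lean/pub/bsd-addord/lit/HFACT-KERNEL-INPUTS.md` §4 (D), §5 K-2/K-5.
-/

set_option autoImplicit false

noncomputable section

open scoped Classical MatrixGroups ModularForm NumberField

open CongruenceSubgroup WeierstrassCurve Literature.NumberTheory.EllipticCurves
  Literature.NumberTheory.EllipticCurves.ModularForms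
  Literature.NumberTheory.EllipticCurves.Disegni2017

namespace Summit.BirchSwinnertonDyer.Rank1Residual.Additive

/-! ### §1 The two Dirichlet-series identities (termwise) -/

section Series

variable (p : ℕ) [hp : Fact p.Prime]

/-- `legendreLevel p n` at a natural number is the Legendre symbol `(k/p)`.
[cite: Disegni2017, Theorem A (arXiv v3 PDF 8)] -/
theorem legendreLevel_natCast {n : ℕ} (hn : n ≠ 0) (k : ℕ) :
    legendreLevel p n hn (k : ZMod (p ^ n)) = (legendreSym p (k : ℤ) : ℂ) := by
  have hpP : p.Prime := hp.out
  rw [legendreLevel_apply p hn, ZMod.val_natCast, legendreSym.mod p ((k % p ^ n : ℕ) : ℤ),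
    legendreSym.mod p (k : ℤ)]
  congr 2
  push_cast
  exact Int.emod_emod_of_dvd _ (dvd_pow_self (p : ℤ) hn)

/-- **`L(f_E ⊗ θ, s) = L(f ⊗ θε, s)` termwise** when `a_n(f_E) = (n/p)·a_n(f)` for all `n`.
[cite: MazurTateTeitelbaum1986Invent, §I.8] -/
theorem twistedLSeries_eq_of_coeff_legendre {N NE : ℕ} {f : CuspForm (Gamma0 N) 2}
    {fE : CuspForm (Gamma0 NE) 2}
    (hE : ∀ n : ℕ, cuspCoeff fE n = (legendreSym p (n : ℤ) : ℂ) * cuspCoeff f n)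
    {m : ℕ} (θ : DirichletCharacter ℂ (p ^ (m + 1))) (s : ℂ) :
    twistedLSeries fE θ s = twistedLSeries f (θ * legendreLevel p (m + 1) (Nat.succ_ne_zero m)) s := by
  unfold twistedLSeries
  congr 1
  funext n
  rw [hE n, MulChar.coeToFun_mul, Pi.mul_apply, legendreLevel_natCast p]
  ring

/-- The product character `θ.mul κ` (Mathlib: both factors moved to level `lcm`) evaluated at a natural
number is `θ(k)·κ(k)`. [cite: Gross2004, §13 (p. 49)] -/
theorem dirichletCharacter_mul_natCast {a b : ℕ} [NeZero a] [NeZero b]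
    (θ : DirichletCharacter ℂ a) (κ : DirichletCharacter ℂ b) (k : ℕ) :
    DirichletCharacter.mul θ κ (k : ZMod (Nat.lcm a b)) = θ (k : ZMod a) * κ (k : ZMod b) := by
  haveI : NeZero (Nat.lcm a b) := ⟨Nat.lcm_ne_zero (NeZero.ne a) (NeZero.ne b)⟩
  rw [DirichletCharacter.mul, MulChar.coeToFun_mul, Pi.mul_apply]
  by_cases hk : IsUnit (k : ZMod (Nat.lcm a b))
  · obtain ⟨u, hu⟩ := hk
    rw [← hu, DirichletCharacter.changeLevel_eq_cast_of_dvd, DirichletCharacter.changeLevel_eq_cast_of_dvd,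
      hu, ZMod.cast_natCast (Nat.dvd_lcm_left a b), ZMod.cast_natCast (Nat.dvd_lcm_right a b)]
  · -- `k` is not a unit mod `lcm a b`: it is a non-unit mod `a` or mod `b`, and both sides vanish
    rw [MulChar.map_nonunit _ hk, zero_mul]
    have hcop : ¬ Nat.Coprime k (Nat.lcm a b) := fun h ↦ hk ((ZMod.isUnit_iff_coprime k _).mpr h)
    by_cases ha : Nat.Coprime k a
    · have hb : ¬ Nat.Coprime k b := fun hb' ↦
        hcop (Nat.Coprime.coprime_dvd_right (Nat.lcm_dvd_mul a b) (Nat.Coprime.mul_right ha hb'))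
      have hkb : ¬ IsUnit (k : ZMod b) := fun h ↦ hb ((ZMod.isUnit_iff_coprime k b).mp h)
      rw [MulChar.map_nonunit _ hkb, mul_zero]
    · have hka : ¬ IsUnit (k : ZMod a) := fun h ↦ ha ((ZMod.isUnit_iff_coprime k a).mp h)
      rw [MulChar.map_nonunit _ hka, zero_mul]

/-- **`L(f_E ⊗ θκ, s) = L(f′ ⊗ θε, s)` termwise** when `a_n(f_E) = (n/p)·a_n(f)` and
`a_n(f′) = κ(n)·a_n(f)` for all `n`. [cite: Gross2004, §13 (p. 49)] -/
theorem twistedLSeries_mul_eq_of_coeff_kronecker {N NE N' b : ℕ} [NeZero b] {f : CuspForm (Gamma0 N) 2}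
    {fE : CuspForm (Gamma0 NE) 2} {f' : CuspForm (Gamma0 N') 2} (κ : DirichletCharacter ℂ b)
    (hE : ∀ n : ℕ, cuspCoeff fE n = (legendreSym p (n : ℤ) : ℂ) * cuspCoeff f n)
    (hV' : ∀ n : ℕ, cuspCoeff f' n = κ (n : ZMod b) * cuspCoeff f n)
    {m : ℕ} (θ : DirichletCharacter ℂ (p ^ (m + 1))) (s : ℂ) :
    twistedLSeries fE (DirichletCharacter.mul θ κ) s =
      twistedLSeries f' (θ * legendreLevel p (m + 1) (Nat.succ_ne_zero m)) s := by
  have hpP : p.Prime := hp.out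
  unfold twistedLSeries
  congr 1
  funext n
  rw [hE n, hV' n, MulChar.coeToFun_mul, Pi.mul_apply, legendreLevel_natCast p,
    dirichletCharacter_mul_natCast]
  ring

end Series

/-! ### §2 The pointwise factorisation at the typed characters -/

section Pointwise

variable {p : ℕ} [hp : Fact p.Prime] (ι : PadicAlgCl p ≃+* ℂ)
  (K : Type) [Field K] [NumberField K] [IsGalois ℚ K]

/-- **Disegni's line function at the twin point of a typed character** (`p ≡ 1 (mod 4)`): if `G`
satisfies Theorem A on the line (`CycLineInterpolation ι K fE α Car G`), then for every even `θ` mod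
`p^{m+1}` of `p`-power order, primitive unless `m = 0`,
`G(χ_θ(γ) − 1) = ι⁻¹(u·Car·Ω⁺_f·Ω⁺_{f′}) · v_f(χ_θ) · v_{f′}(χ_θ)` — Artin formalism (the named fact
`rankinSelbergEulerProductHecke_baseChangeDirichlet_eq`, DISPLAYED as `hArt`) identifies the Rankin–Selberg
Euler product of `f_E` over `K` along `θ∘N` with `L(f⊗θε)·L(f′⊗θε)` (§1), whose entire continuation we take
to be the product of the two continuations; STEP A evaluates Disegni's value there.
[cite: Disegni2017, Theorem A (arXiv v3 PDF 7–8)] [cite: Gross2004, §3 (p. 40), §13 (p. 49)]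
[cite: MazurTateTeitelbaum1986Invent, §I.14 (14.3)] -/
theorem hasLineValueAt_twin_of_cycLineInterpolation (hp4 : p % 4 = 1)
    (hArt : rankinSelbergEulerProductHecke_baseChangeDirichlet_eq)
    (h2 : Module.finrank ℚ K = 2) (κ : DirichletCharacter ℂ (NumberField.discr K).natAbs)
    (hκ : ∀ ℓ : ℕ, ℓ.Prime → ℓ ≠ 2 → κ ℓ = (jacobiSym (NumberField.discr K) ℓ : ℂ))
    (hκ2 : κ 2 = if NumberField.discr K % 8 = 1 then 1
        else if NumberField.discr K % 8 = 5 then -1 else 0)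
    (hpd : Nat.Coprime p (NumberField.discr K).natAbs)
    {N NE N' : ℕ} [NeZero N] [NeZero NE] [NeZero N'] {f : CuspForm (Gamma0 N) 2}
    {fE : CuspForm (Gamma0 NE) 2} {f' : CuspForm (Gamma0 N') 2}
    (hfE : IsNewform0 fE) (hf : IsNewform0 f) (hQ : coeffField f = ⊥) (hf' : IsNewform0 f')
    (hQ' : coeffField f' = ⊥)
    (hE : ∀ n : ℕ, cuspCoeff fE n = (legendreSym p (n : ℤ) : ℂ) * cuspCoeff f n)
    (hV' : ∀ n : ℕ, cuspCoeff f' n = κ (n : ZMod (NumberField.discr K).natAbs) * cuspCoeff f n)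
    {α : ℚ_[p]} {Car : ℝ} {G : PowerSeries ℂ_[p]} (hG : CycLineInterpolation ι K fE α Car G)
    {m : ℕ} (hm : cyclotomicExponent p ≤ m + 1) (θ : DirichletCharacter ℂ (p ^ (m + 1)))
    (heven : θ.Even) (hord : ∃ j : ℕ, orderOf θ = p ^ j) (hprim : θ.IsPrimitive ∨ m = 0) :
    HasLineValueAt G
      (((θ⁻¹.ringHomComp ι.symm.toRingHom).ringHomComp (algebraMap (PadicAlgCl p) ℂ_[p]))
          (cyclotomicGenerator p : ZMod (p ^ (m + 1))) - 1)
      (((ι.symm ((splitLocalConstant p : ℂ) * (Car : ℂ) * (plusPeriod f : ℂ) * (plusPeriod f' : ℂ)) :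
          PadicAlgCl p) : ℂ_[p]) *
        (algebraMap ℚ_[p] ℂ_[p] (α⁻¹ ^ (m + 1)) *
          ∑ b : ZMod (p ^ (m + 1)),
            ((θ⁻¹.ringHomComp ι.symm.toRingHom).ringHomComp (algebraMap (PadicAlgCl p) ℂ_[p])) b *
              algebraMap ℚ_[p] ℂ_[p] (teichWeight p (p / 2)
                (ZMod.castHom (pow_dvd_pow p hm) (ZMod (p ^ cyclotomicExponent p)) b)) *
              (ratPlusSymbol f ((b.val : ℚ) / ((p ^ (m + 1) : ℕ) : ℚ)) : ℂ_[p])) *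
        (algebraMap ℚ_[p] ℂ_[p] (α⁻¹ ^ (m + 1)) *
          ∑ b : ZMod (p ^ (m + 1)),
            ((θ⁻¹.ringHomComp ι.symm.toRingHom).ringHomComp (algebraMap (PadicAlgCl p) ℂ_[p])) b *
              algebraMap ℚ_[p] ℂ_[p] (teichWeight p (p / 2)
                (ZMod.castHom (pow_dvd_pow p hm) (ZMod (p ^ cyclotomicExponent p)) b)) *
              (ratPlusSymbol f' ((b.val : ℚ) / ((p ^ (m + 1) : ℕ) : ℚ)) : ℂ_[p]))) := by
  have hpP : p.Prime := hp.out
  have hp2 : p ≠ 2 := by intro h; rw [h] at hp4; norm_num at hp4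
  haveI : NeZero (NumberField.discr K).natAbs :=
    ⟨Int.natAbs_ne_zero.mpr (NumberField.discr_ne_zero K)⟩
  set ε := legendreLevel p (m + 1) (Nat.succ_ne_zero m) with hε
  -- the two continuations and their product
  obtain ⟨Λ₁, hΛ₁, hΛ₁'⟩ := exists_differentiable_eq_twistedLSeries_holds (f := f) (θ * ε)
  obtain ⟨Λ₂, hΛ₂, hΛ₂'⟩ := exists_differentiable_eq_twistedLSeries_holds (f := f') (θ * ε)
  have hΛ : Differentiable ℂ (fun s ↦ Λ₁ s * Λ₂ s) := hΛ₁.mul hΛ₂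
  -- Artin formalism: the product continues the Rankin–Selberg Euler product along `θ ∘ N`
  have hRS : ∀ s : ℂ, 2 < s.re →
      (fun s ↦ Λ₁ s * Λ₂ s) s = rankinSelbergEulerProductHecke fE (baseChangeDirichlet K θ) s := by
    intro s hs
    simp only
    rw [hΛ₁' s hs, hΛ₂' s hs, ← twistedLSeries_eq_of_coeff_legendre p hE θ s,
      ← twistedLSeries_mul_eq_of_coeff_kronecker p κ hE hV' θ s, baseChangeDirichlet_def]
    rcases Nat.eq_zero_or_pos m with hm0 | hmpos
    · -- `m = 0`: `θ = 1`, and the level-`p` trivial character agrees termwise with the level-`1` one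
      subst hm0
      have hθ1 : θ = 1 := eq_one_of_orderOf_eq_prime_pow_level_prime p hord
      subst hθ1
      haveI : NeZero (1 : ℕ) := ⟨one_ne_zero⟩
      have h1 := hArt K h2 κ hκ hκ2 fE hfE (1 : DirichletCharacter ℂ 1)
        DirichletCharacter.isPrimitive_one_level_one (Nat.coprime_one_left _) s hs
      rw [compRelNorm_ofDirichlet_one K] at h1
      rw [compRelNorm_ofDirichlet_one K, h1]
      -- the two sides are the same Dirichlet series termwise (`a_n(f_E) = 0` when `p ∣ n`)
      have hvan : ∀ n : ℕ, ¬ IsUnit ((n : ZMod (p ^ (0 + 1)))) → cuspCoeff fE n = 0 := by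
        intro n hn
        have hdvd : (p : ℤ) ∣ (n : ℤ) := by
          have hcop : ¬ Nat.Coprime n (p ^ (0 + 1)) := fun h ↦ hn ((ZMod.isUnit_iff_coprime n _).mpr h)
          rw [zero_add, pow_one, Nat.coprime_comm, hpP.coprime_iff_not_dvd, not_not] at hcop
          exact_mod_cast hcop
        have hz : ((n : ℤ) : ZMod p) = 0 := (ZMod.intCast_zmod_eq_zero_iff_dvd (n : ℤ) p).mpr hdvd
        have h0 : legendreSym p (n : ℤ) = 0 := (legendreSym.eq_zero_iff p (n : ℤ)).mpr hz
        rw [hE n, h0, Int.cast_zero, zero_mul]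
      have hone : ∀ n : ℕ, IsUnit ((n : ZMod (p ^ (0 + 1)))) →
          (1 : DirichletCharacter ℂ (p ^ (0 + 1))) (n : ZMod (p ^ (0 + 1))) = 1 :=
        fun n hn ↦ MulChar.one_apply hn
      have hone1 : ∀ n : ℕ, (1 : DirichletCharacter ℂ 1) (n : ZMod 1) = 1 :=
        fun n ↦ MulChar.one_apply (isUnit_of_subsingleton _)
      have hA : twistedLSeries fE (1 : DirichletCharacter ℂ 1) s =
          twistedLSeries fE (1 : DirichletCharacter ℂ (p ^ (0 + 1))) s := by
        unfold twistedLSeries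
        congr 1
        funext n
        by_cases hn : IsUnit ((n : ZMod (p ^ (0 + 1))))
        · rw [hone n hn, hone1 n]
        · rw [hvan n hn, mul_zero, mul_zero]
      have hB : twistedLSeries fE (DirichletCharacter.mul (1 : DirichletCharacter ℂ 1) κ) s =
          twistedLSeries fE (DirichletCharacter.mul (1 : DirichletCharacter ℂ (p ^ (0 + 1))) κ) s := by
        unfold twistedLSeries
        congr 1
        funext n
        rw [dirichletCharacter_mul_natCast, dirichletCharacter_mul_natCast, hone1 n]
        by_cases hn : IsUnit ((n : ZMod (p ^ (0 + 1))))
        · rw [hone n hn]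
        · rw [hvan n hn, mul_zero, mul_zero]
      rw [hA, hB]
    · have hθ : θ.IsPrimitive := hprim.resolve_right (by omega)
      exact (hArt K h2 κ hκ hκ2 fE hfE θ hθ (Nat.Coprime.pow_left _ hpd) s hs).symm
  -- Theorem A at `θ` with this continuation, then STEP A and the twin point
  have hval := hG.hasLineValueAt heven hord hprim hΛ hRS
  rw [cycLineValue_eq_const_mul_branchValues ι hp4 hm θ heven hord hprim hf hQ hf' hQ' α Car hΛ₁ hΛ₁' hΛ₂
    hΛ₂', ← twin_apply_cyclotomicGenerator_sub_one ι θ] at hval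
  exact hval

end Pointwise

end Summit.BirchSwinnertonDyer.Rank1Residual.Additive

end
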